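import Literature.NumberTheory.LFunctions.XiMultiplePositivityProofs
import Literature.NumberTheory.LFunctions.EquivalentsJensenProofs
import Literature.NumberTheory.LFunctions.XiMoments
import Mathlib.Algebra.QuadraticDiscriminant
import Mathlib.LinearAlgebra.Matrix.ToLinearEquiv
import Mathlib.Topology.Instances.Matrix
import Mathlib.GroupTheory.Perm.Fin
import HarnessLib

/-!
# Michałowski's explicit cubic wedge `D_{r,k} > 0` (`r ≥ 2`, `k ≥ 10¹⁸ r³`) for the consecutive
# Toeplitz minors of the `ξ`-coefficients — an unrefereed CLAIM, vendored as a named statement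

Trunk T-NT-LFUNC (Literature/NumberTheory/LFunctions). Companion to Katkova's Theorem 2
(`Literature.NumberTheory.LFunctions.katkova_apf`, `katkova_consecutive_minors_pos`, both
DISCHARGED in `XiMultiplePositivityProofs.lean` with a NON-explicit threshold `N(m)`).

[Michalowski2026] (W. Michałowski, *An explicit uniform cubic wedge for consecutive Toeplitz
minors of the Riemann ξ-coefficients*, arXiv:2607.16795v1, 18 July 2026) writes
`Φ(u) = Σ_{n ≥ 1} (2π²n⁴e^{9u} - 3πn²e^{5u}) e^{-πn²e^{4u}}`,
`(1/8) ξ(1/2 + ix/2) = ∫₀^∞ Φ(u) cos(xu) du`, `a_k = m_{2k}/(2k)!`, `m_{2k} = ∫₀^∞ u^{2k} Φ(u) du`,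
so that `G(z) := Σ_k a_k z^k = (1/8) ξ(1/2 + √z/2)` [Michalowski2026, §1.1 (1)–(2)], and
`D_{r,k} := det [a_{k+j-i}]_{i,j=0}^{r-1}` (`a_ℓ = 0` for `ℓ < 0`) [Michalowski2026, (3)]. His
**Theorem 1.1**: "For every integer `r ≥ 2` and every integer `k ≥ 10¹⁸ r³`, `D_{r,k} > 0`."
The printed proof is a computer-assisted (Arb ball arithmetic) saddle-point/`q`-Pascal argument
(§§3–6, Table 1); it uses no verified zeros of `ζ` [Michalowski2026, Rem. 8.3] and "makes no
progress on the Riemann Hypothesis" [Michalowski2026, Rem. 1.2]. The preprint is UNREFEREED: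
the statement is vendored as a `[claim: …, status: under-review]` named statement
`michalowski_cubic_wedge` (nothing asserted; users take `(h : michalowski_cubic_wedge)`).

**Dictionary (proved).** With the tree's `8 ξ(1/2 + w) = Σ γ(n) w^{2n}/n!`
(`hasSum_xiTaylorCoeff`, `γ = xiTaylorCoeff`; `xiSqCoeff n = γ(n)/(8·n!)`, `hasSum_xiSqCoeff`),
`a_k = γ(k)/(64·4ᵏ·k!)` (`michalowskiCoeff`, `hasSum_michalowskiCoeff`:
`Σ a_k (w²)ᵏ = (1/8) ξ(1/2 + w/2)`). Since `a_k = C λᵏ · (γ(k)/k!)` with `C = 1/64`, `λ = 1/4`,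
`D_{r,k} = (C λᵏ)^r · det [γ(k+j-i)/(k+j-i)!]_{i,j<r}` (`det_scaledShift_eq`,
`michalowskiMinor_eq`), so `D_{r,k} > 0` is exactly positivity of Katkova's consecutive minor
`A_k^r` of `(γ(n)/n!)` as written in `katkova_consecutive_minors_pos` (`michalowskiMinor_pos_iff`).

* `michalowski_cubic_wedge.consecutive_minors_pos` — granted the claim, Katkova's
  consecutive-minor statement holds with the EXPLICIT threshold `N(m) = 10¹⁸ m³`
  (orders `ν = 1` by `γ(k) > 0`, `xiTaylorCoeff_pos_holds`; `2 ≤ ν ≤ m` by the wedge).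

**§2 of the paper, proved (section `CurvatureWindow`).** `michalowskiCoeff_eq_xiMoment`:
`a_k = m_{2k}/(2k)!` with `m_{2k} = xiMoment (2k) = ∫₀^∞ u^{2k} Φ(u) du`, `Φ = deBruijnPhi` — the
paper's definition (2) holds for the tree's objects; `michalowskiQ`/`michalowskiTau` are the
paper's `q_k = a_{k-1}a_{k+1}/a_k²`, `τ_k = -log q_k`; `michalowski_curvature_window` is
[Michalowski2026, **Lemma 2.1**]: `1/(2k) < τ_k < 4/k` for `k ≥ 2` (Cauchy–Schwarz on the moments,
`xiMoment_sq_le_mul`, and the Turán inequalities `γ(n)γ(n+2) ≤ γ(n+1)²`,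
`xiTaylorCoeff_mul_le_sq`, the latter from the tree's `jensenPoly_xiTaylorCoeff_splits_of_le`
instead of Csordas–Norfolk–Varga). Theorem 1.1 itself (Gates A–C, §§3–6, certified numerics) is
NOT proved here.

## References

* W. Michałowski, arXiv:2607.16795v1 (2026), §1.1 (1)–(3), Thm. 1.1, Rem. 1.2, §2 Lemma 2.1 and
  Rem. 2.2, Rem. 8.3. [Michalowski2026] (claim, under review; Lemma 2.1 proved here)
* G. Csordas, T. S. Norfolk, R. S. Varga, Trans. AMS 296 (1986) 521–541 (Turán inequalities).
  [CsordasNorfolkVarga1986]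
* O. M. Katkova, CMFT 7 (2007) 13–31 = arXiv:math/0505174, §2 (10), Thm. 2. [Katkova2006]
-/

noncomputable section

open Complex
open scoped Nat

namespace Literature.NumberTheory.LFunctions

/-! ### Michałowski's coefficients and minors -/

/-- Michałowski's `a_k = m_{2k}/(2k)!`, the Maclaurin coefficients of
`G(z) = (1/8) ξ(1/2 + √z/2)` [Michalowski2026, §1.1 (2)], in closed form through the GORZ
coefficients: `a_k = γ(k)/(64·4ᵏ·k!)` (`hasSum_michalowskiCoeff`). (A definition, not a
claim.) [cite: Michalowski2026, §1.1 (2)] -/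
def michalowskiCoeff (k : ℕ) : ℝ :=
  xiTaylorCoeff k / (64 * 4 ^ k * (k ! : ℝ))

/-- `a_k = (1/64)(1/4)ᵏ · γ(k)/k!`. [folklore] -/
theorem michalowskiCoeff_eq (k : ℕ) :
    michalowskiCoeff k = 1 / 64 * (1 / 4) ^ k * (xiTaylorCoeff k / (k ! : ℝ)) := by
  have h4 : (4 : ℝ) ^ k ≠ 0 := pow_ne_zero _ (by norm_num)
  have hk : (k ! : ℝ) ≠ 0 := by exact_mod_cast k.factorial_ne_zero
  rw [michalowskiCoeff, one_div (4 : ℝ), inv_pow, div_eq_iff (by positivity), eq_comm]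
  field_simp

/-- **`G(w²) = Σ a_k w^{2k} = (1/8) ξ(1/2 + w/2)`**: Michałowski's `a_k` ARE the Maclaurin
coefficients of `(1/8) ξ(1/2 + √z/2)` [Michalowski2026, §1.1 (2)], from the tree's
`Σ γ(n)/(8·n!) (w²)ⁿ = ξ(1/2 + w)` (`hasSum_xiSqCoeff`) at `w/2`. [folklore] -/
theorem hasSum_michalowskiCoeff (w : ℂ) :
    HasSum (fun k => (michalowskiCoeff k : ℂ) * (w ^ 2) ^ k)
      (1 / 8 * riemannXi (1 / 2 + w / 2)) := by
  have h := (hasSum_xiSqCoeff (w / 2)).mul_left (1 / 8)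
  refine h.congr_fun fun k => ?_
  have hsq : ((w / 2) ^ 2) ^ k = (w ^ 2) ^ k / 4 ^ k := by
    rw [div_pow, div_pow]
    norm_num
  rw [hsq, michalowskiCoeff, xiSqCoeff]
  have h4 : (4 : ℂ) ^ k ≠ 0 := pow_ne_zero _ (by norm_num)
  have hk : (k ! : ℂ) ≠ 0 := by exact_mod_cast k.factorial_ne_zero
  push_cast
  field_simp
  ring

/-- Michałowski's consecutive Toeplitz minor `D_{r,k} = det [a_{k+j-i}]_{i,j=0}^{r-1}`, with the
one-sided convention `a_ℓ = 0` for `ℓ < 0` (the guard `i ≤ k + j`; vacuous once `k ≥ r - 1`).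
(A definition, not a claim.) [cite: Michalowski2026, §1.1 (3)] -/
def michalowskiMinor (r k : ℕ) : ℝ :=
  (Matrix.of fun i j : Fin r =>
    if (i : ℕ) ≤ k + j then michalowskiCoeff (k + j - i) else 0).det

/-! ### The claim -/

/-- CLAIM (**Michałowski 2026, Theorem 1.1**, arXiv:2607.16795v1 — UNREFEREED preprint, computer-
assisted proof with Arb certificates): "For every integer `r ≥ 2` and every integer `k ≥ 10¹⁸ r³`,
`D_{r,k} > 0`", where `D_{r,k} = det [a_{k+j-i}]_{i,j=0}^{r-1}` are the consecutive Toeplitz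
minors of the Maclaurin coefficients `a_k` of `(1/8) ξ(1/2 + √z/2)` (`michalowskiMinor`,
`michalowskiCoeff`). Equivalent, minor by minor, to positivity of Katkova's `A_k^r` for
`(γ(n)/n!)` (`michalowskiMinor_pos_iff`). An explicit, uniform-in-`r` version of Katkova's
Theorem 2 threshold in the tail `k ≥ 10¹⁸ r³` only [Michalowski2026, Rem. 1.2: "makes no progress
on the Riemann Hypothesis … the region `k < 10¹⁸ r³` remains completely open"]. Nothing is
asserted; users take `(h : michalowski_cubic_wedge)`.
[claim: Michalowski2026, status: under-review] -/
def michalowski_cubic_wedge : Prop :=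
  ∀ r : ℕ, 2 ≤ r → ∀ k : ℕ, 10 ^ 18 * r ^ 3 ≤ k → 0 < michalowskiMinor r k

/-! ### Change of normalisation: `D_{r,k}` versus Katkova's `A_k^r` for `(γ(n)/n!)` -/

/-- **Rescaling a shifted Toeplitz block.** For `b_n = C λⁿ a_n`,
`det [b_{k+j-i}]_{i,j<r} = (C λᵏ)^r det [a_{k+j-i}]_{i,j<r}` (both with the one-sided guard):
`diag(λⁱ) · [b] = C λᵏ · [a] · diag(λʲ)`. [folklore] -/
theorem det_scaledShift_eq (a : ℕ → ℝ) (C lam : ℝ) (hlam : lam ≠ 0) (r k : ℕ) :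
    (Matrix.of fun i j : Fin r =>
        if (i : ℕ) ≤ k + j then C * lam ^ (k + j - i) * a (k + j - i) else 0).det =
      (C * lam ^ k) ^ r *
        (Matrix.of fun i j : Fin r => if (i : ℕ) ≤ k + j then a (k + j - i) else 0).det := by
  set B : Matrix (Fin r) (Fin r) ℝ := Matrix.of fun i j : Fin r =>
    if (i : ℕ) ≤ k + j then C * lam ^ (k + j - i) * a (k + j - i) else 0 with hB
  set A : Matrix (Fin r) (Fin r) ℝ := Matrix.of fun i j : Fin r =>
    if (i : ℕ) ≤ k + j then a (k + j - i) else 0 with hA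
  set Dl : Matrix (Fin r) (Fin r) ℝ := Matrix.diagonal fun i : Fin r => lam ^ (i : ℕ) with hDl
  have key : Dl * B = (C * lam ^ k) • (A * Dl) := by
    ext i j
    simp only [hDl, hB, hA, Matrix.diagonal_mul, Matrix.mul_diagonal, Matrix.of_apply,
      Matrix.smul_apply, smul_eq_mul]
    split_ifs with h
    · have hpow : lam ^ (i : ℕ) * lam ^ (k + j - i) = lam ^ k * lam ^ (j : ℕ) := by
        rw [← pow_add, ← pow_add, show (i : ℕ) + (k + j - i) = k + j by omega]
      calc lam ^ (i : ℕ) * (C * lam ^ (k + j - i) * a (k + j - i))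
          = C * (lam ^ (i : ℕ) * lam ^ (k + j - i)) * a (k + j - i) := by ring
        _ = C * lam ^ k * (a (k + j - i) * lam ^ (j : ℕ)) := by rw [hpow]; ring
    · simp
  have hdetD : Dl.det = ∏ i : Fin r, lam ^ (i : ℕ) := Matrix.det_diagonal
  have hD0 : Dl.det ≠ 0 := by
    rw [hdetD]
    exact Finset.prod_ne_zero_iff.2 fun i _ => pow_ne_zero _ hlam
  have h1 : Dl.det * B.det = (C * lam ^ k) ^ r * (A.det * Dl.det) := by
    rw [← Matrix.det_mul, key, Matrix.det_smul, Matrix.det_mul, Fintype.card_fin]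
  have h2 : Dl.det * B.det = Dl.det * ((C * lam ^ k) ^ r * A.det) := by rw [h1]; ring
  exact mul_left_cancel₀ hD0 h2

/-- **`D_{r,k} = (4⁻ᵏ/64)^r · A_k^r`**: Michałowski's minor is a positive multiple of Katkova's
consecutive minor of `(γ(n)/n!)` (as written in `katkova_consecutive_minors_pos`). [folklore] -/
theorem michalowskiMinor_eq (r k : ℕ) :
    michalowskiMinor r k = (1 / 64 * (1 / 4) ^ k) ^ r *
      (Matrix.of fun i j : Fin r =>
        if (i : ℕ) ≤ k + j then xiTaylorCoeff (k + j - i) / ((k + j - i)! : ℝ) else 0).det := by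
  have h := det_scaledShift_eq (fun n => xiTaylorCoeff n / (n ! : ℝ)) (1 / 64) (1 / 4)
    (by norm_num) r k
  rw [michalowskiMinor, ← h]
  congr 1
  ext i j
  simp only [Matrix.of_apply]
  split_ifs
  · rw [michalowskiCoeff_eq]
  · rfl

/-- **Sign equivalence**: `D_{r,k} > 0 ↔ A_k^r > 0` for Katkova's `(γ(n)/n!)`. [folklore] -/
theorem michalowskiMinor_pos_iff (r k : ℕ) :
    0 < michalowskiMinor r k ↔ 0 < (Matrix.of fun i j : Fin r =>
      if (i : ℕ) ≤ k + j then xiTaylorCoeff (k + j - i) / ((k + j - i)! : ℝ) else 0).det := by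
  rw [michalowskiMinor_eq]
  have hc : 0 < (1 / 64 * (1 / 4) ^ k : ℝ) ^ r := by positivity
  exact ⟨fun h => pos_of_mul_pos_right h hc.le, fun h => mul_pos hc h⟩

/-! ### Consequences of the claim -/

/-- Granted the claim: `A_k^r > 0` for `(γ(n)/n!)`, `r ≥ 2`, `k ≥ 10¹⁸ r³`.
[claim: Michalowski2026, status: under-review] -/
theorem michalowski_cubic_wedge.katkova_minor_pos (h : michalowski_cubic_wedge) {r : ℕ}
    (hr : 2 ≤ r) {k : ℕ} (hk : 10 ^ 18 * r ^ 3 ≤ k) :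
    0 < (Matrix.of fun i j : Fin r =>
      if (i : ℕ) ≤ k + j then xiTaylorCoeff (k + j - i) / ((k + j - i)! : ℝ) else 0).det :=
  (michalowskiMinor_pos_iff r k).1 (h r hr k hk)

/-- **Granted the claim, Katkova's consecutive-minor statement holds with the explicit threshold
`N(m) = 10¹⁸ m³`**: for `k ≥ 10¹⁸ m³` and `1 ≤ ν ≤ m`, `A_k^ν = det (a_{k+j-l})_{l,j<ν} > 0`,
`a_n = γ(n)/n!` — order `1` is `a_k > 0` (`xiTaylorCoeff_pos_holds`), orders `2 ≤ ν ≤ m` are the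
wedge since `10¹⁸ ν³ ≤ 10¹⁸ m³ ≤ k`. Compare `katkova_consecutive_minors_pos_holds` (unconditional,
inexplicit `N(m)`). [claim: Michalowski2026, status: under-review] -/
theorem michalowski_cubic_wedge.consecutive_minors_pos (h : michalowski_cubic_wedge) (m k : ℕ)
    (hk : 10 ^ 18 * m ^ 3 ≤ k) (ν : ℕ) (hν1 : 1 ≤ ν) (hνm : ν ≤ m) :
    0 < (Matrix.of fun l j : Fin ν =>
      if (l : ℕ) ≤ k + j then xiTaylorCoeff (k + j - l) / ((k + j - l)! : ℝ) else 0).det := by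
  rcases Nat.lt_or_ge ν 2 with hν | hν
  · obtain rfl : ν = 1 := by omega
    rw [Matrix.det_unique]
    simp only [Matrix.of_apply, Fin.default_eq_zero, Fin.val_zero, zero_le, if_true, add_zero,
      Nat.sub_zero]
    exact div_pos (xiTaylorCoeff_pos_holds k) (by positivity)
  · exact h.katkova_minor_pos hν
      (le_trans (Nat.mul_le_mul_left _ (Nat.pow_le_pow_left hνm 3)) hk)

/-- Granted the claim, the named fact `katkova_consecutive_minors_pos` with witness
`N(m) = 10¹⁸ m³` (the fact itself is a theorem of the tree, `katkova_consecutive_minors_pos_holds`;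
the point here is the explicit threshold). [claim: Michalowski2026, status: under-review] -/
theorem michalowski_cubic_wedge.katkova_consecutive_minors_pos_explicit
    (h : michalowski_cubic_wedge) : katkova_consecutive_minors_pos :=
  fun m => ⟨10 ^ 18 * m ^ 3, fun k hk ν hν1 hνm => h.consecutive_minors_pos m k hk ν hν1 hνm⟩

/-! ### §2 of [Michalowski2026]: the moment form of `a_k` and the curvature window (proved)

[Michalowski2026, §1.1 (2)] defines `a_k = m_{2k}/(2k)!`, `m_{2k} = ∫₀^∞ u^{2k} Φ(u) du`, with
`Φ(u) = Σ_{n ≥ 1} (2π²n⁴e^{9u} - 3πn²e^{5u}) e^{-πn²e^{4u}}` — literally the tree's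
`deBruijnPhi` (Rodgers–Tao normalisation, `DeBruijnNewman.lean`) and `xiMoment`
(`XiMoments.lean`), so `michalowskiCoeff k = xiMoment (2k)/(2k)!` (`michalowskiCoeff_eq_xiMoment`,
from `xiTaylorCoeff_eq_xiMoment : γ(n) = 64·4ⁿ·n!/(2n)!·M_{2n}`). [Michalowski2026, §2] puts
`q_k = a_{k-1}a_{k+1}/a_k²`, `τ_k = -log q_k` (`michalowskiQ`, `michalowskiTau`) and proves
**Lemma 2.1** (curvature window): `1/(2k) < τ_k < 4/k` for `k ≥ 2`
(`michalowski_curvature_window`). Upper bound: Cauchy–Schwarz `m_{2k}² ≤ m_{2k-2} m_{2k+2}`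
(`xiMoment_sq_le_mul`, here from the non-negative quadratic form `t ↦ ∫ Φ u^{j}(u² - t)²`) gives
`q_k ≥ (2k)(2k-1)/((2k+2)(2k+1))` (`michalowskiQ_ge`) and `log(1 + x) < x`. Lower bound: the
Turán inequalities `γ(k)² ≥ γ(k-1)γ(k+1)` — in the paper from Csordas–Norfolk–Varga 1986; in the
tree from hyperbolicity of the degree-`2` Jensen polynomials for every shift
(`jensenPoly_xiTaylorCoeff_splits_of_le`, `EquivalentsJensenProofs.lean`, Kim–Lee + the
kernel-certified RH to height `16`) — give `q_k ≤ k/(k+1)` (`michalowskiQ_le`) and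
`log(1 + 1/k) ≥ 1/(k+1) > 1/(2k)`. These are the only inputs of §§3–6 taken from §2. -/

section CurvatureWindow

open MeasureTheory Set Polynomial

/-- **`a_k = m_{2k}/(2k)!`** [Michalowski2026, §1.1 (2)]: Michałowski's Maclaurin coefficient is
the normalised even moment of the Pólya–de Bruijn kernel, `m_{2k} = ∫₀^∞ u^{2k} Φ(u) du =
xiMoment (2k)` (tree: `γ(k) = 64·4ᵏ·k!/(2k)!·M_{2k}`, `xiTaylorCoeff_eq_xiMoment`).
[cite: Michalowski2026, §1.1 (2)] -/
theorem michalowskiCoeff_eq_xiMoment (k : ℕ) :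
    michalowskiCoeff k = xiMoment (2 * k) / ((2 * k)! : ℝ) := by
  rw [michalowskiCoeff, xiTaylorCoeff_eq_xiMoment]
  have h4 : (4 : ℝ) ^ k ≠ 0 := pow_ne_zero _ (by norm_num)
  have hk : (k ! : ℝ) ≠ 0 := by exact_mod_cast k.factorial_ne_zero
  have h2k : ((2 * k)! : ℝ) ≠ 0 := by exact_mod_cast (2 * k).factorial_ne_zero
  field_simp

/-- `a_k > 0` [Michalowski2026, §1.1: "The Maclaurin coefficients (2) … are positive"], from
`Φ > 0` (`xiMoment_pos`). [cite: Michalowski2026, §1.1 (2)] -/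
theorem michalowskiCoeff_pos (k : ℕ) : 0 < michalowskiCoeff k := by
  rw [michalowskiCoeff_eq_xiMoment]
  exact div_pos (xiMoment_pos _) (by exact_mod_cast (2 * k).factorial_pos)

/-- **Cauchy–Schwarz for the moments of `Φ`**: `M_{j+2}² ≤ M_j · M_{j+4}`
(`M_i = ∫₀^∞ Φ(u) uⁱ du`), i.e. `m_{2k}² ≤ m_{2k-2} m_{2k+2}` [Michalowski2026, proof of Lemma 2.1,
"Upper bound"]; here from non-negativity of the quadratic form
`t ↦ ∫₀^∞ Φ(u) uʲ (u² - t)² du = M_j t² - 2 M_{j+2} t + M_{j+4}` and its discriminant.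
[cite: Michalowski2026, Lemma 2.1] -/
theorem xiMoment_sq_le_mul (j : ℕ) : xiMoment (j + 2) ^ 2 ≤ xiMoment j * xiMoment (j + 4) := by
  have hI : ∀ m : ℕ, Integrable (fun u : ℝ => deBruijnPhi u * u ^ m) (volume.restrict (Ioi 0)) :=
    fun m => integrableOn_deBruijnPhi_mul_pow m
  have hq : ∀ t : ℝ, 0 ≤ xiMoment j * (t * t) + -(2 * xiMoment (j + 2)) * t + xiMoment (j + 4) := by
    intro t
    have hnn : 0 ≤ ∫ u in Ioi (0 : ℝ), deBruijnPhi u * u ^ j * (u ^ 2 - t) ^ 2 :=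
      setIntegral_nonneg measurableSet_Ioi fun u hu =>
        mul_nonneg (mul_nonneg (deBruijnPhi_pos_of_nonneg (le_of_lt hu)).le
          (pow_nonneg (le_of_lt hu) _)) (sq_nonneg _)
    have hA := (hI j).const_mul (t * t)
    have hB := (hI (j + 2)).const_mul (2 * t)
    have hC := hI (j + 4)
    have e1 : ∫ u in Ioi (0 : ℝ), deBruijnPhi u * u ^ j * (u ^ 2 - t) ^ 2 =
        ∫ u in Ioi (0 : ℝ), ((t * t * (deBruijnPhi u * u ^ j) -
          2 * t * (deBruijnPhi u * u ^ (j + 2))) + deBruijnPhi u * u ^ (j + 4)) :=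
      setIntegral_congr_fun measurableSet_Ioi fun u _ => by ring
    have e2 : ∫ u in Ioi (0 : ℝ), ((t * t * (deBruijnPhi u * u ^ j) -
          2 * t * (deBruijnPhi u * u ^ (j + 2))) + deBruijnPhi u * u ^ (j + 4)) =
        t * t * xiMoment j - 2 * t * xiMoment (j + 2) + xiMoment (j + 4) := by
      have hAB : Integrable (fun u : ℝ => t * t * (deBruijnPhi u * u ^ j) -
          2 * t * (deBruijnPhi u * u ^ (j + 2))) (volume.restrict (Ioi 0)) := hA.sub hB
      rw [integral_add hAB hC, integral_sub hA hB, integral_const_mul, integral_const_mul]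
      rfl
    have : 0 ≤ t * t * xiMoment j - 2 * t * xiMoment (j + 2) + xiMoment (j + 4) := by
      rw [← e2, ← e1]; exact hnn
    linarith
  have hd := discrim_le_zero hq
  rw [discrim] at hd
  nlinarith [hd]

/-- **Turán's inequalities for the `ξ`-coefficients**: `γ(n) γ(n+2) ≤ γ(n+1)²` for every `n`
(Csordas–Norfolk–Varga 1986, with strict inequality; [Michalowski2026, proof of Lemma 2.1, "Lower
bound" and Rem. 2.2]). In the tree: the degree-`2` Jensen polynomial
`γ(n) + 2γ(n+1)X + γ(n+2)X²` is hyperbolic for every `n` (`jensenPoly_xiTaylorCoeff_splits_of_le`),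
so its discriminant is a square. [cite: Michalowski2026, Lemma 2.1] -/
theorem xiTaylorCoeff_mul_le_sq (n : ℕ) :
    xiTaylorCoeff n * xiTaylorCoeff (n + 2) ≤ xiTaylorCoeff (n + 1) ^ 2 := by
  have hs : (jensenPoly xiTaylorCoeff 2 n).Splits :=
    jensenPoly_xiTaylorCoeff_splits_of_le (by norm_num) n
  have hnd : (jensenPoly xiTaylorCoeff 2 n).natDegree = 2 :=
    natDegree_jensenPoly _ _ _ (xiTaylorCoeff_pos_holds (n + 2)).ne'
  have hdeg : (jensenPoly xiTaylorCoeff 2 n).degree ≠ 0 := by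
    intro h0
    have := Polynomial.natDegree_eq_zero_iff_degree_le_zero.2 h0.le
    omega
  obtain ⟨x, hx⟩ := hs.exists_eval_eq_zero hdeg
  have heval : (jensenPoly xiTaylorCoeff 2 n).eval x =
      xiTaylorCoeff (n + 2) * (x * x) + 2 * xiTaylorCoeff (n + 1) * x + xiTaylorCoeff n := by
    simp only [jensenPoly, Finset.sum_range_succ, Finset.sum_range_zero, eval_add, eval_mul,
      eval_C, eval_pow, eval_X, zero_add]
    norm_num [Nat.choose]
    ring
  rw [heval] at hx
  have hd := discrim_eq_sq_of_quadratic_eq_zero hx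
  rw [discrim] at hd
  nlinarith [hd, sq_nonneg (2 * xiTaylorCoeff (n + 2) * x + 2 * xiTaylorCoeff (n + 1))]

/-- Michałowski's ratio `q_k = a_{k-1} a_{k+1}/a_k²` [Michalowski2026, §1.3 Gate B and §2:
"Throughout, `q_k = a_{k-1}a_{k+1}/a_k²`"]. Meaningful for `k ≥ 1` (at `k = 0` the `ℕ`-subtraction
gives the junk value `a_0 a_1/a_0²`). (A definition, not a claim.) [cite: Michalowski2026, §2] -/
def michalowskiQ (k : ℕ) : ℝ :=
  michalowskiCoeff (k - 1) * michalowskiCoeff (k + 1) / michalowskiCoeff k ^ 2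

/-- Michałowski's `τ_k = -log q_k` [Michalowski2026, §2: "`τ_k = -log q_k`"], the local
log-concavity parameter of `(a_k)` (the comparison model of Gate B is `c_s = q_k^{s(s-1)/2}`).
(A definition, not a claim.) [cite: Michalowski2026, §2] -/
def michalowskiTau (k : ℕ) : ℝ :=
  -Real.log (michalowskiQ k)

/-- `q_k > 0` [Michalowski2026, §2: "Positivity of `Φ` makes `a_k > 0`, so `q_k > 0`"].
[cite: Michalowski2026, §2] -/
theorem michalowskiQ_pos (k : ℕ) : 0 < michalowskiQ k :=
  div_pos (mul_pos (michalowskiCoeff_pos _) (michalowskiCoeff_pos _)) (pow_pos (michalowskiCoeff_pos _) 2)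

/-- `q_{m+1}` through the moments: `q_{m+1} = (M_{2m} M_{2m+4}/M_{2m+2}²) ·
(2m+2)(2m+1)/((2m+4)(2m+3))` [Michalowski2026, proof of Lemma 2.1: "`q_k = (1/μ_k) ·
(2k)(2k-1)/((2k+2)(2k+1))`, `μ_k = m_{2k}²/(m_{2k-2}m_{2k+2})`", with `k = m + 1`]. [folklore] -/
theorem michalowskiQ_succ_eq_xiMoment (m : ℕ) :
    michalowskiQ (m + 1) = xiMoment (2 * m) * xiMoment (2 * m + 4) / xiMoment (2 * m + 2) ^ 2 *
      ((2 * m + 2) * (2 * m + 1) / ((2 * m + 4) * (2 * m + 3)) : ℝ) := by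
  rw [michalowskiQ, Nat.add_sub_cancel, michalowskiCoeff_eq_xiMoment, michalowskiCoeff_eq_xiMoment,
    michalowskiCoeff_eq_xiMoment]
  have e1 : 2 * (m + 1) = 2 * m + 1 + 1 := by ring
  have e2 : 2 * (m + 1 + 1) = 2 * m + 1 + 1 + 1 + 1 := by ring
  have h1 : ((2 * (m + 1))! : ℝ) = (2 * m + 2) * (2 * m + 1) * ((2 * m)! : ℝ) := by
    rw [e1, Nat.factorial_succ, Nat.factorial_succ]; push_cast; ring
  have h2 : ((2 * (m + 1 + 1))! : ℝ) =
      (2 * m + 4) * (2 * m + 3) * (2 * m + 2) * (2 * m + 1) * ((2 * m)! : ℝ) := by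
    rw [e2, Nat.factorial_succ, Nat.factorial_succ, Nat.factorial_succ, Nat.factorial_succ]
    push_cast; ring
  rw [h1, h2, e1, e2]
  have hF : ((2 * m)! : ℝ) ≠ 0 := by exact_mod_cast (2 * m).factorial_ne_zero
  have hM : xiMoment (2 * m + 1 + 1) ≠ 0 := (xiMoment_pos _).ne'
  have hm0 : (0 : ℝ) ≤ m := Nat.cast_nonneg m
  field_simp

/-- `q_{m+1}` through the GORZ coefficients: `q_{m+1} = (γ(m)γ(m+2)/γ(m+1)²) · (m+1)/(m+2)`
(`a_k = γ(k)/(64·4ᵏ·k!)`, so `a_{k-1}a_{k+1}/a_k² = γ(k-1)γ(k+1)/γ(k)² · k/(k+1)`, the CNV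
normalisation matching of [Michalowski2026, Rem. 2.2]). [folklore] -/
theorem michalowskiQ_succ_eq_xiTaylorCoeff (m : ℕ) :
    michalowskiQ (m + 1) = xiTaylorCoeff m * xiTaylorCoeff (m + 2) / xiTaylorCoeff (m + 1) ^ 2 *
      ((m + 1) / (m + 2) : ℝ) := by
  rw [michalowskiQ, Nat.add_sub_cancel]
  simp only [michalowskiCoeff]
  have h1 : ((m + 1)! : ℝ) = (m + 1) * (m ! : ℝ) := by
    rw [Nat.factorial_succ]; push_cast; ring
  have h2 : ((m + 1 + 1)! : ℝ) = (m + 2) * (m + 1) * (m ! : ℝ) := by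
    rw [Nat.factorial_succ, Nat.factorial_succ]; push_cast; ring
  rw [h1, h2, pow_succ, pow_succ]
  have hF : (m ! : ℝ) ≠ 0 := by exact_mod_cast m.factorial_ne_zero
  have h4 : (4 : ℝ) ^ m ≠ 0 := pow_ne_zero _ (by norm_num)
  have hγ : xiTaylorCoeff (m + 1) ≠ 0 := (xiTaylorCoeff_pos_holds _).ne'
  have hm0 : (0 : ℝ) ≤ m := Nat.cast_nonneg m
  field_simp

/-- **Lower bound for `q_k`** [Michalowski2026, proof of Lemma 2.1, "Upper bound":
"`q_k ≥ (2k)(2k-1)/((2k+2)(2k+1))`"], from Cauchy–Schwarz `μ_k ≤ 1` (`xiMoment_sq_le_mul`);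
stated with `k = m + 1 ≥ 1`. [cite: Michalowski2026, Lemma 2.1] -/
theorem michalowskiQ_ge (m : ℕ) :
    ((2 * m + 2) * (2 * m + 1) / ((2 * m + 4) * (2 * m + 3)) : ℝ) ≤ michalowskiQ (m + 1) := by
  rw [michalowskiQ_succ_eq_xiMoment]
  have hm0 : (0 : ℝ) ≤ m := Nat.cast_nonneg m
  have hc : (0 : ℝ) ≤ (2 * m + 2) * (2 * m + 1) / ((2 * m + 4) * (2 * m + 3)) := by positivity
  have hμ : 1 ≤ xiMoment (2 * m) * xiMoment (2 * m + 4) / xiMoment (2 * m + 2) ^ 2 := by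
    rw [le_div_iff₀ (pow_pos (xiMoment_pos _) 2), one_mul]
    exact xiMoment_sq_le_mul (2 * m)
  calc ((2 * m + 2) * (2 * m + 1) / ((2 * m + 4) * (2 * m + 3)) : ℝ)
      = 1 * ((2 * m + 2) * (2 * m + 1) / ((2 * m + 4) * (2 * m + 3))) := (one_mul _).symm
    _ ≤ _ := mul_le_mul_of_nonneg_right hμ hc

/-- **Upper bound for `q_k`** [Michalowski2026, proof of Lemma 2.1, "Lower bound":
"`q_k < k/(k+1)`" from the Turán inequalities]; here the non-strict `q_k ≤ k/(k+1)` from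
`xiTaylorCoeff_mul_le_sq`, stated with `k = m + 1 ≥ 1`. [cite: Michalowski2026, Lemma 2.1] -/
theorem michalowskiQ_le (m : ℕ) : michalowskiQ (m + 1) ≤ ((m + 1) / (m + 2) : ℝ) := by
  rw [michalowskiQ_succ_eq_xiTaylorCoeff]
  have hm0 : (0 : ℝ) ≤ m := Nat.cast_nonneg m
  have hc : (0 : ℝ) ≤ (m + 1) / (m + 2) := by positivity
  have hT : xiTaylorCoeff m * xiTaylorCoeff (m + 2) / xiTaylorCoeff (m + 1) ^ 2 ≤ 1 := by
    rw [div_le_iff₀ (pow_pos (xiTaylorCoeff_pos_holds _) 2), one_mul]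
    exact xiTaylorCoeff_mul_le_sq m
  calc xiTaylorCoeff m * xiTaylorCoeff (m + 2) / xiTaylorCoeff (m + 1) ^ 2 * ((m + 1) / (m + 2))
      ≤ 1 * ((m + 1) / (m + 2)) := mul_le_mul_of_nonneg_right hT hc
    _ = _ := one_mul _

/-- `q_k < 1` for `k ≥ 1` (strict log-concavity of `(a_k)` at every index), from `q_k ≤ k/(k+1)`.
[cite: Michalowski2026, Lemma 2.1] -/
theorem michalowskiQ_lt_one (m : ℕ) : michalowskiQ (m + 1) < 1 := by
  have hm0 : (0 : ℝ) ≤ m := Nat.cast_nonneg m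
  have h : ((m + 1) / (m + 2) : ℝ) < 1 := by
    rw [div_lt_one (by positivity)]; linarith
  exact (michalowskiQ_le m).trans_lt h

/-- **Lemma 2.1 of [Michalowski2026], upper half**: `τ_k < 4/k` for `k ≥ 2`. From
`q_k ≥ (2k)(2k-1)/((2k+2)(2k+1))`: `τ_k ≤ log((2k+2)(2k+1)/((2k)(2k-1))) =
log(1 + (8k+2)/(4k²-2k)) < (8k+2)/(4k²-2k) ≤ 4/k`, "the last step being `(4k+1)/(2k-1) ≤ 4` for
`k ≥ 2`". [cite: Michalowski2026, Lemma 2.1] -/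
theorem michalowskiTau_lt {k : ℕ} (hk : 2 ≤ k) : michalowskiTau k < 4 / k := by
  obtain ⟨m, rfl⟩ : ∃ m, k = m + 1 := ⟨k - 1, by omega⟩
  have hm1 : (1 : ℝ) ≤ m := by exact_mod_cast (show 1 ≤ m by omega)
  set L : ℝ := (2 * m + 2) * (2 * m + 1) / ((2 * m + 4) * (2 * m + 3)) with hL
  have hLpos : 0 < L := by positivity
  have hqL : L ≤ michalowskiQ (m + 1) := michalowskiQ_ge m
  -- `τ = -log q ≤ -log L = log L⁻¹ < L⁻¹ - 1 ≤ 4/k`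
  have h1 : michalowskiTau (m + 1) ≤ Real.log L⁻¹ := by
    rw [michalowskiTau, Real.log_inv]
    exact neg_le_neg (Real.log_le_log hLpos hqL)
  have hLinv : L⁻¹ = ((2 * m + 4) * (2 * m + 3) / ((2 * m + 2) * (2 * m + 1)) : ℝ) := by
    rw [hL, inv_div]
  have hne : L⁻¹ ≠ 1 := by
    rw [hLinv, Ne, div_eq_one_iff_eq (by positivity)]
    intro h; nlinarith
  have h2 : Real.log L⁻¹ < L⁻¹ - 1 := Real.log_lt_sub_one_of_pos (inv_pos.2 hLpos) hne
  have h3 : L⁻¹ - 1 ≤ 4 / ((m + 1 : ℕ) : ℝ) := by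
    rw [hLinv, div_sub_one (by positivity), div_le_div_iff₀ (by positivity) (by positivity)]
    push_cast
    nlinarith
  linarith

/-- **Lemma 2.1 of [Michalowski2026], lower half**: `1/(2k) < τ_k` for `k ≥ 2`. From
`q_k ≤ k/(k+1)`: `τ_k ≥ log((k+1)/k) = log(1 + 1/k) ≥ 1 - k/(k+1) = 1/(k+1) > 1/(2k)`.
(The paper uses `log(1+x) > x - x²/2 ≥ x/2`; either way `k ≥ 2` suffices, and `k = 1` also holds
via `log 2 > 1/2`, not recorded.) [cite: Michalowski2026, Lemma 2.1] -/
theorem michalowskiTau_gt {k : ℕ} (hk : 2 ≤ k) : 1 / (2 * (k : ℝ)) < michalowskiTau k := by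
  obtain ⟨m, rfl⟩ : ∃ m, k = m + 1 := ⟨k - 1, by omega⟩
  have hm1 : (1 : ℝ) ≤ m := by exact_mod_cast (show 1 ≤ m by omega)
  set U : ℝ := (m + 1) / (m + 2) with hU
  have hUpos : 0 < U := by positivity
  have hq0 : 0 < michalowskiQ (m + 1) := michalowskiQ_pos _
  have hqU : michalowskiQ (m + 1) ≤ U := michalowskiQ_le m
  -- `τ = -log q ≥ -log U = log U⁻¹ ≥ 1 - U = 1/(k+1) > 1/(2k)`
  have h1 : Real.log U⁻¹ ≤ michalowskiTau (m + 1) := by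
    rw [michalowskiTau, Real.log_inv]
    exact neg_le_neg (Real.log_le_log hq0 hqU)
  have h2 : 1 - U ≤ Real.log U⁻¹ := by
    have := Real.one_sub_inv_le_log_of_pos (inv_pos.2 hUpos)
    rwa [inv_inv] at this
  have h3 : 1 / (2 * ((m + 1 : ℕ) : ℝ)) < 1 - U := by
    rw [hU, one_sub_div (by positivity), div_lt_div_iff₀ (by positivity) (by positivity)]
    push_cast
    nlinarith
  linarith

/-- **[Michalowski2026, Lemma 2.1] (curvature window), proved**: for every `k ≥ 2`,
`1/(2k) < τ_k < 4/k`, where `τ_k = -log q_k`, `q_k = a_{k-1}a_{k+1}/a_k²` and `a_k` are the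
Maclaurin coefficients of `(1/8) ξ(1/2 + √z/2)`. The paper's lower-bound input (the CNV Turán
inequalities) is replaced by the tree's `jensenPoly_xiTaylorCoeff_splits_of_le`; the upper bound
is Cauchy–Schwarz on the moments of `Φ`, as printed. This is the whole of §2, the only part of the
paper used by Gates A–C that does not depend on the certified numerics of Table 1.
[cite: Michalowski2026, Lemma 2.1] -/
theorem michalowski_curvature_window {k : ℕ} (hk : 2 ≤ k) :
    1 / (2 * (k : ℝ)) < michalowskiTau k ∧ michalowskiTau k < 4 / k :=
  ⟨michalowskiTau_gt hk, michalowskiTau_lt hk⟩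

/-- In particular `0 < τ_k` and `0 < q_k < 1` for `k ≥ 2`: the comparison model
`c_s = q_k^{s(s-1)/2}` of Gate B is a genuine (strictly log-concave) Gaussian profile.
[cite: Michalowski2026, Lemma 2.1] -/
theorem michalowskiTau_pos {k : ℕ} (hk : 2 ≤ k) : 0 < michalowskiTau k :=
  lt_trans (by positivity) (michalowskiTau_gt hk)

end CurvatureWindow

/-! ### §6 of [Michalowski2026]: inertia preservation and the sign of the minor (proved)

[Michalowski2026, §6] deduces `D_{r,k} > 0` from a factorisation of the COLUMN-REVERSED block
`Q^ξ_{ij} = a_{k+s}`, `s = (r-1)-i-j` (a symmetric reversed-Hankel block) as a whitened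
perturbation `Q = S̃ (J + F) S̃ᵀ` of the signature matrix `J = diag((-1)^m)` with `‖F‖₂ < 1`
(Lemma 6.1: inertia preservation; Lemma 6.2: `det T = (-1)^{C(r,2)} det Q > 0` for `Q` of inertia
`(⌈r/2⌉, ⌊r/2⌋)`). We prove the determinant form of this assembly for arbitrary real matrices:
`CubicWedge.sign_revPerm` (the reversal of `Fin n` has sign `(-1)^{n(n-1)/2}`),
`CubicWedge.det_submatrix_rev`, `CubicWedge.det_signature` (`det J = (-1)^{n(n-1)/2}`),
`CubicWedge.mulVec_signature_add_eq_zero` / `CubicWedge.signature_det_pos` (Lemma 6.1 in the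
form `(-1)^{n(n-1)/2} det(J + F) > 0` whenever `Σ(Fv)ᵢ² ≤ c²Σvᵢ²`, `c < 1`: no eigenvalue of
`J + θF` crosses zero, intermediate value theorem), and `CubicWedge.det_pos_of_reversal_factor`
(Lemmas 6.1 + 6.2: `det T > 0`). `michalowskiMinor_pos_of_reversal_factor` is the resulting
REDUCTION of Theorem 1.1 to the outputs of Gates B–C: it remains to produce, for `r ≥ 2` and
`k ≥ 10¹⁸ r³`, the factor `S̃ = √(a_k ρ^{r-1} c_{r-1}) · diag(ρ^{-i}) A L|D|^{1/2}` and the bound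
`‖|D|^{-1/2}L⁻¹(V∘(e^{h_s}-1))L⁻ᵀ|D|^{-1/2}‖₂ ≤ ‖e^h - 1‖_A ≤ 0.14005` [Michalowski2026, Proof of
Theorem 1.1, p. 14], which is where the certified analysis (Prop. 3.7, Prop. 4.4, Prop. 5.4) enters. -/

namespace CubicWedge

open Equiv Finset

/-! #### The sign of the order-reversing permutation of `Fin n` -/

/-- For permutations of `Fin n`, Mathlib's `sign` agrees with the inversion-count product
`signAux`. [folklore] -/
theorem sign_eq_signAux {n : ℕ} (f : Perm (Fin n)) : Perm.sign f = Perm.signAux f := by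
  have key : ∀ (s : Multiset (Fin n)) (hs : ∀ x, x ∈ s), Perm.signAux3 f hs = Perm.signAux f := by
    intro s
    induction s using Quotient.inductionOn with
    | h l =>
      intro hs
      change Perm.signAux2 l f = Perm.signAux f
      rw [← Perm.signAux_eq_signAux2 l f (Equiv.refl _) (fun x _ => hs x)]
      rfl
  exact key _ Finset.mem_univ

/-- There are `n(n-1)/2` pairs `b < a` in `Fin n`. [folklore] -/
theorem card_finPairsLT (n : ℕ) : (Perm.finPairsLT n).card = n * (n - 1) / 2 := by
  rw [Perm.finPairsLT, Finset.card_sigma]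
  simp only [Finset.card_attachFin, Finset.card_range]
  rw [Fin.sum_univ_eq_sum_range (fun i => i) n, Finset.sum_range_id]

/-- **The order-reversing permutation of `Fin n` has sign `(-1)^{n(n-1)/2}`** (every pair is an
inversion); stated in `ℤ`. [folklore] -/
theorem sign_revPerm (n : ℕ) :
    ((Perm.sign (Fin.revPerm : Perm (Fin n)) : ℤˣ) : ℤ) = (-1) ^ (n * (n - 1) / 2) := by
  have h1 : Perm.sign (Fin.revPerm : Perm (Fin n)) = ∏ _x ∈ Perm.finPairsLT n, (-1 : ℤˣ) := by
    rw [sign_eq_signAux, Perm.signAux]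
    refine Finset.prod_congr rfl fun x hx => ?_
    rw [if_pos]
    rw [Fin.revPerm_apply, Fin.revPerm_apply, Fin.rev_le_rev]
    exact (Perm.mem_finPairsLT.1 hx).le
  rw [h1, Finset.prod_const, card_finPairsLT, Units.val_pow_eq_pow_val, Units.val_neg,
    Units.val_one]

/-- Determinant of a column-reversed matrix: `det [Q_{i, n-1-j}] = (-1)^{n(n-1)/2} det Q`.
[folklore] -/
theorem det_submatrix_rev {R : Type*} [CommRing R] {n : ℕ} (Q : Matrix (Fin n) (Fin n) R) :
    (Q.submatrix id Fin.rev).det = (-1) ^ (n * (n - 1) / 2) * Q.det := by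
  have h : Q.submatrix id Fin.rev = Q.submatrix id (Fin.revPerm : Perm (Fin n)) := rfl
  rw [h, Matrix.det_permute', sign_revPerm, Int.cast_pow, Int.cast_neg, Int.cast_one]

/-- The signature matrix `J = diag((-1)^i)_{i<n}` has `det J = (-1)^{n(n-1)/2}`. [folklore] -/
theorem det_signature (n : ℕ) :
    (Matrix.diagonal fun i : Fin n => ((-1 : ℝ) ^ (i : ℕ))).det = (-1) ^ (n * (n - 1) / 2) := by
  rw [Matrix.det_diagonal, Finset.prod_pow_eq_pow_sum, Fin.sum_univ_eq_sum_range (fun i => i) n,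
    Finset.sum_range_id]

/-! #### Inertia preservation in determinant form -/

/-- If `Σᵢ (F v)ᵢ² ≤ c² Σᵢ vᵢ²` with `0 ≤ c < 1`, then `J + θF` (`J = diag((-1)^i)`, `0 ≤ θ ≤ 1`)
has trivial kernel: `(J + θF)v = 0 ⇒ Σ vᵢ² = θ² Σ (Fv)ᵢ² ≤ θ²c² Σ vᵢ²`. This is the
finite-dimensional core of [Michalowski2026, Lemma 6.1] (there with the spectral norm
`‖F‖₂ < 1`). [cite: Michalowski2026, Lemma 6.1] -/
theorem mulVec_signature_add_eq_zero {n : ℕ} (F : Matrix (Fin n) (Fin n) ℝ) {c : ℝ} (hc0 : 0 ≤ c)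
    (hc : c < 1) (hF : ∀ v : Fin n → ℝ, ∑ i, (F.mulVec v i) ^ 2 ≤ c ^ 2 * ∑ i, v i ^ 2)
    {θ : ℝ} (hθ0 : 0 ≤ θ) (hθ1 : θ ≤ 1) {v : Fin n → ℝ}
    (hv : ((Matrix.diagonal fun i : Fin n => ((-1 : ℝ) ^ (i : ℕ))) + θ • F).mulVec v = 0) :
    v = 0 := by
  set J : Matrix (Fin n) (Fin n) ℝ := Matrix.diagonal fun i : Fin n => ((-1 : ℝ) ^ (i : ℕ)) with hJ
  -- componentwise: `(-1)^i v i + θ (F v) i = 0`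
  have hcomp : ∀ i : Fin n, (-1 : ℝ) ^ (i : ℕ) * v i = -(θ * F.mulVec v i) := by
    intro i
    have := congrFun hv i
    rw [Matrix.add_mulVec, Pi.add_apply, Pi.zero_apply, hJ, Matrix.mulVec_diagonal,
      Matrix.smul_mulVec, Pi.smul_apply, smul_eq_mul] at this
    linarith
  have hsq : ∀ i : Fin n, v i ^ 2 = θ ^ 2 * F.mulVec v i ^ 2 := by
    intro i
    have h1 : ((-1 : ℝ) ^ (i : ℕ)) ^ 2 = 1 := by
      rw [← pow_mul, mul_comm, pow_mul, neg_one_sq, one_pow]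
    calc v i ^ 2 = ((-1 : ℝ) ^ (i : ℕ)) ^ 2 * v i ^ 2 := by rw [h1, one_mul]
      _ = ((-1 : ℝ) ^ (i : ℕ) * v i) ^ 2 := by ring
      _ = θ ^ 2 * F.mulVec v i ^ 2 := by rw [hcomp i]; ring
  have hsum : ∑ i, v i ^ 2 = θ ^ 2 * ∑ i, F.mulVec v i ^ 2 := by
    rw [Finset.mul_sum]; exact Finset.sum_congr rfl fun i _ => hsq i
  have hS0 : 0 ≤ ∑ i, v i ^ 2 := Finset.sum_nonneg fun i _ => sq_nonneg _
  have hθc : θ ^ 2 * c ^ 2 < 1 := by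
    have h1 : θ ^ 2 ≤ 1 := by nlinarith
    have h2 : c ^ 2 < 1 := by nlinarith
    calc θ ^ 2 * c ^ 2 ≤ 1 * c ^ 2 := by gcongr
      _ < 1 := by linarith
  have hle : ∑ i, v i ^ 2 ≤ θ ^ 2 * c ^ 2 * ∑ i, v i ^ 2 := by
    calc ∑ i, v i ^ 2 = θ ^ 2 * ∑ i, F.mulVec v i ^ 2 := hsum
      _ ≤ θ ^ 2 * (c ^ 2 * ∑ i, v i ^ 2) := by gcongr; exact hF v
      _ = θ ^ 2 * c ^ 2 * ∑ i, v i ^ 2 := by ring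
  have hzero : ∑ i, v i ^ 2 = 0 := by nlinarith
  funext i
  have := (Finset.sum_eq_zero_iff_of_nonneg fun i _ => sq_nonneg (v i)).1 hzero i (Finset.mem_univ i)
  exact pow_eq_zero_iff two_ne_zero |>.1 this

/-- **[Michalowski2026, Lemma 6.1] in determinant form**: with `J = diag((-1)^i)` and a real
`n × n` matrix `F` satisfying `Σ (Fv)ᵢ² ≤ c² Σ vᵢ²`, `c < 1`, the determinant of `J + F` has the
sign of `det J = (-1)^{n(n-1)/2}`: `(-1)^{n(n-1)/2} det(J + F) > 0` (the eigenvalues of the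
symmetric family `J + θF` never cross zero; here: `det(J + θF) ≠ 0` on `[0,1]` by
`mulVec_signature_add_eq_zero`, and the intermediate value theorem). [cite: Michalowski2026, Lemma 6.1] -/
theorem signature_det_pos {n : ℕ} (F : Matrix (Fin n) (Fin n) ℝ) {c : ℝ} (hc0 : 0 ≤ c) (hc : c < 1)
    (hF : ∀ v : Fin n → ℝ, ∑ i, (F.mulVec v i) ^ 2 ≤ c ^ 2 * ∑ i, v i ^ 2) :
    0 < (-1 : ℝ) ^ (n * (n - 1) / 2) *
      ((Matrix.diagonal fun i : Fin n => ((-1 : ℝ) ^ (i : ℕ))) + F).det := by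
  set J : Matrix (Fin n) (Fin n) ℝ := Matrix.diagonal fun i : Fin n => ((-1 : ℝ) ^ (i : ℕ)) with hJ
  -- the path `g θ = (-1)^{…} det (J + θ F)`
  set g : ℝ → ℝ := fun θ => (-1 : ℝ) ^ (n * (n - 1) / 2) * (J + θ • F).det with hg
  have hg_cont : Continuous g := by
    refine continuous_const.mul ?_
    refine Continuous.matrix_det ?_
    exact continuous_const.add (continuous_id.smul continuous_const)
  have hg_ne : ∀ θ ∈ Set.Icc (0 : ℝ) 1, g θ ≠ 0 := by
    intro θ hθ hzero
    have hdet : (J + θ • F).det = 0 := by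
      rcases mul_eq_zero.1 hzero with h | h
      · exact absurd h (pow_ne_zero _ (by norm_num))
      · exact h
    obtain ⟨v, hv0, hv⟩ := Matrix.exists_mulVec_eq_zero_iff.2 hdet
    exact hv0 (mulVec_signature_add_eq_zero F hc0 hc hF hθ.1 hθ.2 hv)
  have hg0 : g 0 = 1 := by
    simp only [hg]
    rw [zero_smul, add_zero, hJ, det_signature, ← pow_add, ← two_mul, pow_mul, neg_one_sq, one_pow]
  have hg1 : g 1 = (-1 : ℝ) ^ (n * (n - 1) / 2) * (J + F).det := by
    simp only [hg, one_smul]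
  -- intermediate value theorem on `[0, 1]`
  by_contra hneg
  push Not at hneg
  rw [← hg1] at hneg
  have hIVT : (0 : ℝ) ∈ g '' Set.Icc (0 : ℝ) 1 := by
    have hsub := intermediate_value_Icc' (zero_le_one' ℝ) hg_cont.continuousOn
    exact hsub ⟨hneg, by rw [hg0]; exact zero_le_one⟩
  obtain ⟨θ, hθ, hθ0⟩ := hIVT
  exact hg_ne θ hθ hθ0

/-- **[Michalowski2026, §6: Lemmas 6.1 + 6.2 assembled]**: let `T` be a real `n × n` matrix whose
column reversal `Q = [T_{i, n-1-j}]` factors as `Q = S (J + F) Sᵀ` with `det S ≠ 0`,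
`J = diag((-1)^i)` and `Σ (Fv)ᵢ² ≤ c² Σ vᵢ²` for some `c < 1`. Then `det T > 0`
(`det T = (-1)^{n(n-1)/2} det Q`, `det Q = (det S)² det(J + F)`, and
`(-1)^{n(n-1)/2} det(J + F) > 0`). [cite: Michalowski2026, Lemma 6.2] -/
theorem det_pos_of_reversal_factor {n : ℕ} (T S F : Matrix (Fin n) (Fin n) ℝ) {c : ℝ}
    (hc0 : 0 ≤ c) (hc : c < 1)
    (hF : ∀ v : Fin n → ℝ, ∑ i, (F.mulVec v i) ^ 2 ≤ c ^ 2 * ∑ i, v i ^ 2) (hS : S.det ≠ 0)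
    (hQ : T.submatrix id Fin.rev =
      S * ((Matrix.diagonal fun i : Fin n => ((-1 : ℝ) ^ (i : ℕ))) + F) * S.transpose) :
    0 < T.det := by
  have hrev : T = (T.submatrix id Fin.rev).submatrix id Fin.rev := by
    ext i j; simp [Matrix.submatrix_apply, Fin.rev_rev]
  have h1 : T.det = (-1 : ℝ) ^ (n * (n - 1) / 2) * (S.det ^ 2 *
      ((Matrix.diagonal fun i : Fin n => ((-1 : ℝ) ^ (i : ℕ))) + F).det) := by
    conv_lhs => rw [hrev, det_submatrix_rev, hQ]
    rw [Matrix.det_mul, Matrix.det_mul, Matrix.det_transpose]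
    ring
  rw [h1]
  have hS2 : 0 < S.det ^ 2 := by positivity
  have key := signature_det_pos F hc0 hc hF
  nlinarith [mul_pos hS2 key]

end CubicWedge

/-- **Reduction of [Michalowski2026, Thm. 1.1] to Gates B–C** (the "Conclusion" paragraph of the
Proof of Theorem 1.1, p. 14): if the column reversal `Q^ξ = [a_{k+(r-1-j)-i}]_{i,j<r}` of the
Toeplitz block `T^ξ = [a_{k+j-i}]` factors as `S (J + F) Sᵀ` with `det S ≠ 0`, `J = diag((-1)^i)`
and `Σ(Fv)ᵢ² ≤ c² Σvᵢ²` for some `c < 1` (in the paper: `S = S̃ = √c_{r-1} A L|D|^{1/2}` up to the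
positive normalisations, `F = S̃⁻¹ E S̃⁻ᵀ`, `c = ‖e^h - 1‖_A ≤ 0.14005`), then `D_{r,k} > 0`.
[cite: Michalowski2026, Theorem 1.1 (proof, §6)] -/
theorem michalowskiMinor_pos_of_reversal_factor (r k : ℕ) (S F : Matrix (Fin r) (Fin r) ℝ)
    {c : ℝ} (hc0 : 0 ≤ c) (hc : c < 1)
    (hF : ∀ v : Fin r → ℝ, ∑ i, (F.mulVec v i) ^ 2 ≤ c ^ 2 * ∑ i, v i ^ 2) (hS : S.det ≠ 0)
    (hQ : (Matrix.of fun i j : Fin r =>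
        if (i : ℕ) ≤ k + j then michalowskiCoeff (k + j - i) else 0).submatrix id Fin.rev =
      S * ((Matrix.diagonal fun i : Fin r => ((-1 : ℝ) ^ (i : ℕ))) + F) * S.transpose) :
    0 < michalowskiMinor r k :=
  CubicWedge.det_pos_of_reversal_factor _ S F hc0 hc hF hS hQ

end Literature.NumberTheory.LFunctions

end
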